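import Literature.NumberTheory.GaloisRepresentations.AbsDecompositionFiniteLevelDictionary
import Literature.NumberTheory.GaloisRepresentations.NeukirchUchidaKummerPackage
import Mathlib.FieldTheory.Finite.Basic
import HarnessLib

/-!
# Roots of unity at a nonarchimedean prime of `F̄`: `ℓ ∤ 𝔭` bookkeeping and `μ_ℓ ⊆ K ⟹ ℓ ∣ N𝔭 - 1`

Topic `Literature/NumberTheory/GaloisRepresentations` (continues `AbsDecompositionFiniteLevelDictionary`).
PROOF-ONLY (theorems, no definition, no named fact).  abc-iut cell, GAP row G-L4d2g4-1, sub-DAG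
`plan/L4/SUBDAG-NeukirchUchida.md` row **R3 FINITE-LEVEL DICTIONARY**, item (R3.6); seat abc-iut-w5-d201;
classical, outside the [IUTchIII] Cor. 3.12 cone — nothing here takes a side there.

For a number field `K ⊆ F̄` (`K : IntermediateField F (AlgebraicClosure F)`), a valuation subring `A` of `F̄`
lying over the ideal `P` of `𝓞 K` (`∀ x : 𝓞 K, ((x : K) : F̄) ∈ A.nonunits ↔ x ∈ P`) and a prime `ℓ`:

* `natCast_mem_nonunits_iff` — `(ℓ : F̄) ∈ 𝔪_A ↔ (ℓ : 𝓞 K) ∈ P` ("`𝔭 ∣ ℓ`" read at `A` or in `𝓞 K`);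
* `dvd_card_quotient_sub_one_of_isPrimitiveRoot` — FINITE LEVEL: if `𝓞 N` contains a primitive `ℓ`-th root
  of unity and the maximal ideal `𝔮` of `𝓞 N` does not contain `ℓ`, then `ℓ ∣ N𝔮 - 1`, `N𝔮 = #(𝓞 N ⧸ 𝔮)`
  (the root stays of order `ℓ` in the residue field, Neukirch I (10.4) — the tree's
  `NeukirchUchidaProof.sub_one_not_mem` —, and the unit group of the residue field has order `N𝔮 - 1`);
* `dvd_card_quotient_sub_one_of_mem` — the same read at `A`: `ζ ∈ K` a primitive `ℓ`-th root of unity of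
  `F̄`, `A ≠ ⊤` over `P` with `(ℓ : F̄) ∉ 𝔪_A` ⟹ `ℓ ∣ #(𝓞 K ⧸ P) - 1`.

These feed row R8 (K4) `exists_pow_div_sub_one_not_mem` (unit residues of order not dividing `(N𝔮-1)/ℓ`).

## References
* [NeukirchANT1999] J. Neukirch, *Algebraic Number Theory* (1999), Ch. I §10 Prop. (10.4) (primes `𝔭 ∤ ℓ`
  are unramified in `ℚ(ζ_ℓ)`: the roots of unity stay distinct mod `𝔭`), Ch. V §3 Lemma (3.5).
-/

noncomputable section

open Field NumberField IsDedekindDomain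

namespace Literature.NumberTheory.GaloisRepresentations

variable {F : Type} [Field F] [NumberField F]

omit [NumberField F] in
/-- **`𝔭 ∣ ℓ` read at the valuation ring**: for `A` over the ideal `P` of `𝓞 K`, `(n : F̄) ∈ 𝔪_A ↔ (n : 𝓞 K) ∈ P`.
[cite: NeukirchANT1999, Ch. II (8.6)] -/
theorem natCast_mem_nonunits_iff (K : IntermediateField F (AlgebraicClosure F))
    {A : ValuationSubring (AlgebraicClosure F)} {P : Ideal (𝓞 K)}
    (hPA : ∀ x : 𝓞 K, ((x : K) : AlgebraicClosure F) ∈ A.nonunits ↔ x ∈ P) (n : ℕ) :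
    ((n : ℕ) : AlgebraicClosure F) ∈ A.nonunits ↔ (n : 𝓞 K) ∈ P := by
  rw [← hPA]
  have h : (((n : 𝓞 K) : K) : AlgebraicClosure F) = n := by
    have h1 : ((n : 𝓞 K) : K) = n := map_natCast (algebraMap (𝓞 K) K) n
    rw [h1]
    exact map_natCast (algebraMap K (AlgebraicClosure F)) n
  rw [h]

/-- **`μ_ℓ ⊆ 𝓞 N` and `𝔮 ∤ ℓ` force `ℓ ∣ N𝔮 - 1`** (FINITE LEVEL).  If the ring of integers of a number field
`N` contains a primitive `ℓ`-th root of unity `ζ` (`ℓ` prime) and `𝔮` is a maximal ideal of `𝓞 N` with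
`ℓ ∉ 𝔮`, then `ℓ` divides `#(𝓞 N ⧸ 𝔮) - 1`: the residue of `ζ` is `≠ 1` (`NeukirchUchidaProof.sub_one_not_mem`,
Neukirch I (10.4)) with `ℓ`-th power `1`, so it has order `ℓ` in the residue field, whose nonzero elements
satisfy `a ^ (N𝔮 - 1) = 1`. [cite: NeukirchANT1999, Ch. I §10 Prop. (10.4)] -/
theorem dvd_card_quotient_sub_one_of_isPrimitiveRoot {N : Type*} [Field N] [NumberField N] {ℓ : ℕ}
    (hℓ : ℓ.Prime) {ζ : 𝓞 N} (hζ : IsPrimitiveRoot ζ ℓ) (𝔮 : Ideal (𝓞 N)) [𝔮.IsMaximal]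
    (hq : (ℓ : 𝓞 N) ∉ 𝔮) : ℓ ∣ Nat.card (𝓞 N ⧸ 𝔮) - 1 := by
  classical
  haveI : Fact ℓ.Prime := ⟨hℓ⟩
  letI := Ideal.Quotient.field 𝔮
  have hqbot : 𝔮 ≠ ⊥ := Ring.ne_bot_of_isMaximal_of_not_isField inferInstance (RingOfIntegers.not_isField N)
  haveI : Finite (𝓞 N ⧸ 𝔮) := Ideal.finiteQuotientOfFreeOfNeBot 𝔮 hqbot
  haveI : Fintype (𝓞 N ⧸ 𝔮) := Fintype.ofFinite _
  set z : 𝓞 N ⧸ 𝔮 := Ideal.Quotient.mk 𝔮 ζ with hz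
  have hzℓ : z ^ ℓ = 1 := by rw [hz, ← map_pow, hζ.pow_eq_one, map_one]
  have hz1 : z ≠ 1 := by
    intro h
    rw [hz, ← map_one (Ideal.Quotient.mk 𝔮), Ideal.Quotient.eq] at h
    exact NeukirchUchidaProof.sub_one_not_mem hℓ hζ hq h
  have hz0 : z ≠ 0 := by
    intro h
    rw [h, zero_pow hℓ.ne_zero] at hzℓ
    exact zero_ne_one hzℓ
  have hord : orderOf z = ℓ := orderOf_eq_prime hzℓ hz1
  have hdvd : orderOf z ∣ Fintype.card (𝓞 N ⧸ 𝔮) - 1 :=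
    orderOf_dvd_of_pow_eq_one (FiniteField.pow_card_sub_one_eq_one z hz0)
  rwa [hord, ← Nat.card_eq_fintype_card] at hdvd

/-- **`μ_ℓ ⊆ K` and `ℓ ∉ 𝔪_A` force `ℓ ∣ #(𝓞 K ⧸ P) - 1`**, read at a nonarchimedean prime `A ≠ ⊤` of `F̄`
over the ideal `P` of `𝓞 K`: if `K` contains a primitive `ℓ`-th root of unity of `F̄` (`ℓ` prime) and
`(ℓ : F̄) ∉ 𝔪_A`, then `ℓ ∣ #(𝓞 K ⧸ P) - 1` (`dvd_card_quotient_sub_one_of_isPrimitiveRoot` for the maximal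
ideal `P`, the root being integral). [cite: NeukirchANT1999, Ch. I §10 Prop. (10.4)] -/
theorem dvd_card_quotient_sub_one_of_mem (K : IntermediateField F (AlgebraicClosure F))
    [FiniteDimensional F K] {A : ValuationSubring (AlgebraicClosure F)} (hA : A ≠ ⊤) {P : Ideal (𝓞 K)}
    (hPA : ∀ x : 𝓞 K, ((x : K) : AlgebraicClosure F) ∈ A.nonunits ↔ x ∈ P) {ℓ : ℕ} (hℓ : ℓ.Prime)
    {ζ : AlgebraicClosure F} (hζK : ζ ∈ K) (hζ : IsPrimitiveRoot ζ ℓ)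
    (hℓA : ((ℓ : ℕ) : AlgebraicClosure F) ∉ A.nonunits) :
    ℓ ∣ Nat.card (𝓞 K ⧸ P) - 1 := by
  haveI : NumberField K := NumberField.of_module_finite F K
  haveI : P.IsMaximal := isMaximal_of_below K A hA hPA
  -- `ζ` as an element of `𝓞 K`, still a primitive `ℓ`-th root of unity
  have hζint : IsIntegral ℤ (⟨ζ, hζK⟩ : K) :=
    (isIntegral_algHom_iff (IsScalarTower.toAlgHom ℤ K (AlgebraicClosure F))
      (algebraMap K (AlgebraicClosure F)).injective).mp (hζ.isIntegral hℓ.pos)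
  set ζ₀ : 𝓞 K := ⟨⟨ζ, hζK⟩, hζint⟩ with hζ₀
  have hζ₀ℓ : IsPrimitiveRoot ζ₀ ℓ := by
    refine IsPrimitiveRoot.of_map_of_injective
      (f := (algebraMap K (AlgebraicClosure F)).toMonoidHom.comp (algebraMap (𝓞 K) K).toMonoidHom) ?_ ?_
    · exact hζ
    · exact (algebraMap K (AlgebraicClosure F)).injective.comp (FaithfulSMul.algebraMap_injective (𝓞 K) K)
  have hℓP : (ℓ : 𝓞 K) ∉ P := by rwa [← natCast_mem_nonunits_iff K hPA]
  exact dvd_card_quotient_sub_one_of_isPrimitiveRoot hℓ hζ₀ℓ P hℓP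

end Literature.NumberTheory.GaloisRepresentations

end
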